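import Summits.BirchSwinnertonDyer.BirchSwinnertonDyer.Theorems.BiquadraticEisensteinDescentHeegnerTwistCouplingInSupplySqrtSevenCorner
import HarnessLib

set_option linter.dupNamespace false -- `Summit.BirchSwinnertonDyer.BirchSwinnertonDyer.Theorems.…` (summit = sub)
set_option autoImplicit false

/-!
# Crux `HeegnerTwistCouplingInSupply` (stmt-BirchSwinnertonDyer-21381) — the `j = −3375` corner, PIN-FREE RUNGS for the other inert half
# `p ≡ 1 (mod 4)` (`p ≡ 5, 13, 17 (mod 28)`): `W = X₀(49)^{(−p)} = ⟨0, −21p, 0, 112p², 0⟩`, fixed Heegner fields `K′ = ℚ(√−q₃q₅q₁)`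
# (`(q₃, q₅, q₁) ≡ (3, 5, 1) (mod 8)` primes inert in `ℚ(√−7)`), each rung covering the primes `p` with `(−q₃q₅q₁/p) = +1`

Route `BiquadraticEisensteinDescent` (cell `pub/bsd-wall`, width seat `bsd-wall-cm-bed-w1` g11; `--supports` 21381, helper). Sequel of `…SqrtSevenCorner`
(the `p ≡ 3 (mod 8)` half, pin-based, every prime). For `p ≡ 1 (mod 4)` the twist `X₀(49)^{(−p)}` is additive at `2` (`2 ∣ N`), so a Heegner
discriminant must be `≡ 1 (mod 8)`; CELL-√7 (`…SqrtSevenCell`: one prime `≡ 3 (mod 8)`, the others `≡ 1 (mod 4)`, all inert in `ℚ(√−7)`) and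
`7` split then force `|d| = q₃q₅q₁` with THREE primes of residues `3, 5, 1 (mod 8)` — no size room for a pinned prime, but none is needed: the field is
FIXED, `h(K′)` is a kernel value (`BinQF.classNumber`, `decide`), and the rung applies to every `p > h(K′)` with `(−q₃q₅q₁/p) = +1`:

* §1 the family `W⁻_p = ⟨0, −21p, 0, 112p², 0⟩`: `Δ = −2¹²7³p⁶`, good reduction away from `{2, 7, p}`, support of `N`, twist identity
  `W⁻_p^{(−m)} = A_{mp}`;
* §2 ★ `rung_of_two_facts` — generic rung: for fixed primes `q₃ ≡ 3`, `q₅ ≡ 5`, `q₁ ≡ 1 (mod 8)` with `(·/7) = −1` and `h(−q₃q₅q₁) = h₀`: for every prime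
  `p ≡ 1 (mod 4)` with `(p/7) = −1`, `(−q₃q₅q₁/p) = +1`, `h₀ < p`, `p ∉ {q₅, q₁}`: the crux conclusion for `W = W⁻_p` with `K′ = ℚ(√−q₃q₅q₁)`, modulo
  Burungale–Tian + Deuring–Hecke (cell with `q = q₃`, `m = q₅q₁p`);
* §3 ★★ eight rungs `m ∈ {255, 615, 663, 1095, 1335, 1455, 1599, 1615}` (`h = 12, 20, 16, 28, 28, 28, 36, 24`): residual density `2⁻⁸` in the class.

HONEST FRAMING: a ladder on one CM family (never all `p ≡ 1 (mod 4)`: the symbols `(q/p)` of fixed partners are free); nothing about C⁺; crux 21381 NOT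
closed; BSD is not proved by any of this. THEOREMS ONLY (no `def`, no `sorry`, no new named fact).
-/

noncomputable section

open scoped Classical NumberField

namespace Summit.BirchSwinnertonDyer.BirchSwinnertonDyer.Theorems.BiquadraticEisensteinDescentHeegnerTwistCouplingInSupplySqrtSevenRungs

open _root_.WeierstrassCurve Literature.NumberTheory.EllipticCurves Literature.NumberTheory
open Literature.NumberTheory.QuadraticFields Literature.NumberTheory.QuadraticFields.Quadratic
open IsDedekindDomain Rat.HeightOneSpectrum
open Summit.BirchSwinnertonDyer.BirchSwinnertonDyer.Theorems.BiquadraticEisensteinDescentHeegnerTwistCouplingInSupplySqrtSevenCell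
open Summit.BirchSwinnertonDyer.BirchSwinnertonDyer.Theorems.BiquadraticEisensteinDescentHeegnerTwistCouplingInSupplySqrtSevenCorner

/-! ## §1 The family `W⁻_p = ⟨0, −21p, 0, 112p², 0⟩` (`= X₀(49)^{(−p)}` in two-torsion form) -/

section Family

/-- The `ℤ`-model maps to `W⁻_p`. [folklore] -/
theorem map_WnegInt (p : ℕ) :
    (⟨0, -21 * (p : ℤ), 0, 112 * (p : ℤ) ^ 2, 0⟩ : WeierstrassCurve ℤ).map (Int.castRingHom ℚ) = ⟨0, -21 * (p : ℚ), 0, 112 * (p : ℚ) ^ 2, 0⟩ := by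
  ext <;> simp [WeierstrassCurve.map]

/-- `Δ(W⁻_p) = −2¹²·7³·p⁶`. [cite: SilvermanAEC2009, III.1] -/
theorem WnegInt_Δ (p : ℕ) : (⟨0, -21 * (p : ℤ), 0, 112 * (p : ℤ) ^ 2, 0⟩ : WeierstrassCurve ℤ).Δ = -1404928 * (p : ℤ) ^ 6 := by
  simp only [WeierstrassCurve.Δ, WeierstrassCurve.b₂, WeierstrassCurve.b₄, WeierstrassCurve.b₆, WeierstrassCurve.b₈]
  ring

/-- A prime `r ∉ {2, 7, p}` does not divide `Δ(W⁻_p)`. [folklore] -/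
theorem not_dvd_WnegInt_Δ {p r : ℕ} (hp : p.Prime) (hr : r.Prime) (hr2 : r ≠ 2) (hr7 : r ≠ 7) (hrp : r ≠ p) :
    ¬ (r : ℤ) ∣ (⟨0, -21 * (p : ℤ), 0, 112 * (p : ℤ) ^ 2, 0⟩ : WeierstrassCurve ℤ).Δ := by
  rw [WnegInt_Δ, show (-1404928 * (p : ℤ) ^ 6) = -((2 ^ 12 * 7 ^ 3 * p ^ 6 : ℕ) : ℤ) by push_cast; ring, dvd_neg]
  intro h
  have h' : r ∣ 2 ^ 12 * 7 ^ 3 * p ^ 6 := by exact_mod_cast h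
  rcases (Nat.Prime.dvd_mul hr).mp h' with h27 | hp6
  · rcases (Nat.Prime.dvd_mul hr).mp h27 with h2 | h7
    · exact hr2 ((Nat.prime_dvd_prime_iff_eq hr Nat.prime_two).mp (hr.dvd_of_dvd_pow h2))
    · exact hr7 ((Nat.prime_dvd_prime_iff_eq hr (by norm_num)).mp (hr.dvd_of_dvd_pow h7))
  · exact hrp ((Nat.prime_dvd_prime_iff_eq hr hp).mp (hr.dvd_of_dvd_pow hp6))

/-- `W⁻_p` has good reduction at every prime `r ∉ {2, 7, p}`. [cite: SilvermanAEC2009, VII.5 Prop. 5.1(a)] -/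
theorem hasGoodReductionAtPrime_Wneg {p r : ℕ} [Fact r.Prime] (hp : p.Prime) (hr2 : r ≠ 2) (hr7 : r ≠ 7) (hrp : r ≠ p) :
    (⟨0, -21 * (p : ℚ), 0, 112 * (p : ℚ) ^ 2, 0⟩ : WeierstrassCurve ℚ).HasGoodReductionAtPrime r := by
  obtain ⟨v, rfl⟩ : ∃ v : HeightOneSpectrum (𝓞 ℚ), (primesEquiv v : ℕ) = r :=
    ⟨primesEquiv.symm ⟨r, Fact.out⟩, by rw [Equiv.apply_symm_apply]⟩
  rw [← map_WnegInt]
  exact (hasGoodReductionAtPrime_iff_hasGoodReductionAt_ringOfIntegers v _).2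
    (hasGoodReductionAt_map_of_not_dvd _ v (not_dvd_WnegInt_Δ hp Fact.out hr2 hr7 hrp))

/-- Every prime divisor of `N(W⁻_p)` is `2`, `7` or `p`. [cite: SilvermanATAEC1994, Thm. IV.10.2(a)] -/
theorem prime_dvd_conductorNorm_Wneg {p r : ℕ} (hp : p.Prime) [(⟨0, -21 * (p : ℚ), 0, 112 * (p : ℚ) ^ 2, 0⟩ : WeierstrassCurve ℚ).IsElliptic]
    (hr : r.Prime) (h : r ∣ (⟨0, -21 * (p : ℚ), 0, 112 * (p : ℚ) ^ 2, 0⟩ : WeierstrassCurve ℚ).conductorNorm ℤ) :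
    r = 2 ∨ r = 7 ∨ r = p := by
  by_contra hne
  push Not at hne
  haveI : Fact r.Prime := ⟨hr⟩
  exact not_dvd_conductorNorm_of_hasGoodReductionAtPrime _ (hasGoodReductionAtPrime_Wneg hp hne.1 hne.2.1 hne.2.2) h

/-- `W⁻_p` is an elliptic curve for a prime `p`. [folklore] -/
theorem isElliptic_Wneg (p : ℕ) (hp : p.Prime) : (⟨0, -21 * (p : ℚ), 0, 112 * (p : ℚ) ^ 2, 0⟩ : WeierstrassCurve ℚ).IsElliptic := by
  rw [isElliptic_mk_twoTorsion_iff,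
    show (16 : ℚ) * (112 * (p : ℚ) ^ 2) ^ 2 * ((-21 * (p : ℚ)) ^ 2 - 4 * (112 * (p : ℚ) ^ 2)) = -1404928 * (p : ℚ) ^ 6 by ring]
  have : (p : ℚ) ≠ 0 := by exact_mod_cast hp.ne_zero
  exact mul_ne_zero (by norm_num) (pow_ne_zero 6 this)

/-- **`j(W⁻_p) = −3375` and `W⁻_p` has CM** (for the record; `j_A` of the corner file at `n = p` after `W⁻_p = A_{−p}`-type sign bookkeeping is avoided:
direct computation). [cite: SilvermanATAEC1994, App. A §3] -/
theorem j_Wneg_and_hasCM {p : ℕ} (hp : p.Prime) [hE : (⟨0, -21 * (p : ℚ), 0, 112 * (p : ℚ) ^ 2, 0⟩ : WeierstrassCurve ℚ).IsElliptic] :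
    (⟨0, -21 * (p : ℚ), 0, 112 * (p : ℚ) ^ 2, 0⟩ : WeierstrassCurve ℚ).j = -3375 ∧
      (⟨0, -21 * (p : ℚ), 0, 112 * (p : ℚ) ^ 2, 0⟩ : WeierstrassCurve ℚ).HasCM := by
  have hj : (⟨0, -21 * (p : ℚ), 0, 112 * (p : ℚ) ^ 2, 0⟩ : WeierstrassCurve ℚ).j = -3375 := by
    rw [j_mk_twoTorsion]
    have h6 : (p : ℚ) ^ 6 ≠ 0 := pow_ne_zero 6 (by exact_mod_cast hp.ne_zero)
    have hb : (112 * (p : ℚ) ^ 2) ^ 2 * ((-21 * (p : ℚ)) ^ 2 - 4 * (112 * (p : ℚ) ^ 2)) = -87808 * (p : ℚ) ^ 6 := by ring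
    rw [div_eq_iff (by rw [hb]; exact mul_ne_zero (by norm_num) h6), hb]
    ring
  refine ⟨hj, hasCM_of_j_mem_maximalCMJInvariants_holds _ ?_⟩
  rw [hj]; simp [maximalCMJInvariants]

/-- ★ **The twist identity `W⁻_p^{(−m)} = A_{mp}` on the nose.** [cite: SilvermanAEC2009, X.5 Cor. 5.4(iii)] -/
theorem quadraticTwist_Wneg (p m : ℕ) :
    (⟨0, -21 * (p : ℚ), 0, 112 * (p : ℚ) ^ 2, 0⟩ : WeierstrassCurve ℚ).quadraticTwist (((-(m : ℤ)) : ℤ) : ℚ) =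
      ⟨0, 21 * ((m * p : ℕ) : ℚ), 0, 112 * ((m * p : ℕ) : ℚ) ^ 2, 0⟩ := by
  ext
  · simp
  · simp only [quadraticTwist_a₂, b₂]; push_cast; ring
  · simp
  · simp only [quadraticTwist_a₄, b₄]; push_cast; ring
  · simp only [quadraticTwist_a₆, b₆]; push_cast; ring

end Family

/-! ## §2 The generic rung -/

section Rung

/-- ★ **Generic pin-free rung.** Fix primes `q₃ ≡ 3 (mod 8)`, `q₅`, `q₁ ≡ 1 (mod 4)` (all `≡ 3, 5, 6 (mod 7)`, distinct from each other, with
`q₃q₅q₁ ≡ 7 (mod 8)`) and the kernel value `h₀ = h(−q₃q₅q₁)`. Then for every prime `p ≡ 1 (mod 4)` with `(p/7) = −1`, `(−q₃q₅q₁/p) = +1`,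
`h₀ < p` and `p ∉ {q₅, q₁}`, the CONCLUSION of crux 21381 holds for `W = W⁻_p` with `K′ = ℚ(√−q₃q₅q₁)`: `d = −q₃q₅q₁ ≡ 1 (mod 8)` (`2` splits),
`(d/7) = +1` (three non-residues and `(−1/7) = −1`), `(d/p) = +1` (the rung hypothesis), `W⁻_p^{(d)} = A_{q₃·(q₅q₁p)}` in CELL-√7, `h(K′) = h₀ < p`
— modulo Burungale–Tian + Deuring–Hecke. [cite: BurungaleTian2026, Thm. 1.1] [cite: SilvermanATAEC1994, Ch. II Cor. 10.5.1]
[cite: Cox2013, §2.A Thm. 2.13 and §7.B Thm. 7.7(ii)] -/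
theorem rung_of_two_facts (hBT : burungaleTian_analyticRank_eq_zero_of_selmerCorank_eq_zero_of_hasCM)
    (hH : hasEntireLFunction_of_j_mem_maximalCMJInvariants) {q₃ q₅ q₁ m h₀ : ℕ} (hm : m = q₃ * q₅ * q₁) (hq₃ : q₃.Prime) (hq₅ : q₅.Prime)
    (hq₁ : q₁.Prime) (hq₃8 : q₃ % 8 = 3) (hq₅4 : q₅ % 4 = 1) (hq₁4 : q₁ % 4 = 1) (h8 : m % 8 = 7)
    (hq₃7 : q₃ % 7 = 3 ∨ q₃ % 7 = 5 ∨ q₃ % 7 = 6) (hq₅7 : q₅ % 7 = 3 ∨ q₅ % 7 = 5 ∨ q₅ % 7 = 6) (hq₁7 : q₁ % 7 = 3 ∨ q₁ % 7 = 5 ∨ q₁ % 7 = 6)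
    (hne : q₅ ≠ q₁) (hJ7 : jacobiSym (-(m : ℤ)) 7 = 1) (hh : BinQF.classNumber (-(m : ℤ)) = h₀) :
    ∀ (p : ℕ) [Fact p.Prime], p % 4 = 1 → (p % 7 = 3 ∨ p % 7 = 5 ∨ p % 7 = 6) → jacobiSym (-(m : ℤ)) p = 1 → h₀ < p →
      ∃ (K : Type) (_ : Field K) (_ : NumberField K),
        IsImaginaryQuadratic K ∧ 4 < (NumberField.discr K).natAbs ∧
        SatisfiesHeegnerHypothesis ((⟨0, -21 * (p : ℚ), 0, 112 * (p : ℚ) ^ 2, 0⟩ : WeierstrassCurve ℚ).conductorNorm ℤ) K ∧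
        ((⟨0, -21 * (p : ℚ), 0, 112 * (p : ℚ) ^ 2, 0⟩ : WeierstrassCurve ℚ).quadraticTwist (NumberField.discr K : ℚ)).entireLFunction 1 ≠ 0 ∧
        NumberField.classNumber K < p ∧ ¬ p ∣ NumberField.classNumber K := by
  intro p hpF hp4 hp7 hJp hh₀
  have hp : p.Prime := hpF.out
  haveI := isElliptic_Wneg p hp
  have hm0 : 0 < m := by rw [hm]; exact Nat.mul_pos (Nat.mul_pos hq₃.pos hq₅.pos) hq₁.pos
  -- `p ∤ m` (else the symbol `(−m/p)` would vanish), so `p ≠ q₅, q₁`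
  have hpm : ¬ p ∣ m := fun hdvd => by
    rw [jacobiSym.mod_left, Int.emod_eq_zero_of_dvd ((Int.natCast_dvd_natCast.mpr hdvd).neg_right),
      jacobiSym.zero_left hp.one_lt] at hJp
    exact zero_ne_one hJp
  have hp₅ : p ≠ q₅ := by rintro rfl; exact hpm ⟨q₃ * q₁, by rw [hm]; ring⟩
  have hp₁ : p ≠ q₁ := by rintro rfl; exact hpm ⟨q₃ * q₅, by rw [hm]; ring⟩
  have hmZ' : (0 : ℤ) < m := by exact_mod_cast hm0
  have hmZ : (-(m : ℤ)) < 0 := by linarith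
  haveI : Fact ((-(m : ℤ)) < 0) := ⟨hmZ⟩
  -- the field
  have hq₃5 : q₃ ≠ q₅ := by rintro rfl; omega
  have hq₃1 : q₃ ≠ q₁ := by rintro rfl; omega
  have hc1 : Nat.Coprime (q₃ * q₅) q₁ :=
    Nat.Coprime.mul_left ((Nat.coprime_primes hq₃ hq₁).mpr hq₃1) ((Nat.coprime_primes hq₅ hq₁).mpr hne)
  have hc2 : Nat.Coprime q₃ q₅ := (Nat.coprime_primes hq₃ hq₅).mpr hq₃5
  have hmsq : Squarefree m := by
    rw [hm, Nat.squarefree_mul hc1, Nat.squarefree_mul hc2]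
    exact ⟨⟨hq₃.squarefree, hq₅.squarefree⟩, hq₁.squarefree⟩
  have hsf : Squarefree (-(m : ℤ)).natAbs := by rw [Int.natAbs_neg, Int.natAbs_natCast]; exact hmsq
  have hD8 : (-(m : ℤ)) % 8 = 1 := by omega
  obtain ⟨hK, hdK⟩ := isImaginaryQuadratic_and_discr_sqrtField_of_squarefree_natAbs (-(m : ℤ)) (by omega) hsf
  have hHg : SatisfiesHeegnerHypothesis ((⟨0, -21 * (p : ℚ), 0, 112 * (p : ℚ) ^ 2, 0⟩ : WeierstrassCurve ℚ).conductorNorm ℤ)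
      (sqrtField (-(m : ℤ))) :=
    satisfiesHeegnerHypothesis_sqrtField_of_squarefree_natAbs _ hD8 hsf fun r hr hrN => by
      rcases prime_dvd_conductorNorm_Wneg hp hr hrN with rfl | rfl | rfl
      · exact Or.inl rfl
      · exact Or.inr hJ7
      · exact Or.inr hJp
  have hcl : NumberField.classNumber (sqrtField (-(m : ℤ))) < p := by
    rw [ClassNumberValues.classNumber_eq_of_discr_eq hK.1 hdK hmZ hh]; exact hh₀
  refine ⟨sqrtField (-(m : ℤ)), inferInstance, inferInstance, hK, ?_, hHg, ?_, hcl, fun hdvd =>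
    absurd (Nat.le_of_dvd (NumberField.classNumber_pos _) hdvd) (not_le.mpr hcl)⟩
  · rw [hdK, Int.natAbs_neg, Int.natAbs_natCast, hm]
    have := hq₃.two_le; have := hq₅.two_le; have := hq₁.two_le
    nlinarith [Nat.mul_le_mul (Nat.mul_le_mul hq₃.two_le hq₅.two_le) hq₁.two_le]
  · -- `W⁻_p^{(−m)} = A_{m p} = A_{q₃ · (q₅ q₁ p)}` in CELL-√7
    rw [hdK, quadraticTwist_Wneg, show (m * p : ℕ) = q₃ * (q₅ * q₁ * p) by rw [hm]; ring]
    have hq₃m : ¬ q₃ ∣ q₅ * q₁ * p := by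
      intro h
      rcases (Nat.Prime.dvd_mul hq₃).mp h with h | h
      · rcases (Nat.Prime.dvd_mul hq₃).mp h with h | h
        · exact hq₃5 ((Nat.prime_dvd_prime_iff_eq hq₃ hq₅).mp h)
        · exact hq₃1 ((Nat.prime_dvd_prime_iff_eq hq₃ hq₁).mp h)
      · have := (Nat.prime_dvd_prime_iff_eq hq₃ hp).mp h; omega
    have hm'sq : Squarefree (q₅ * q₁ * p) := by
      rw [Nat.squarefree_mul (Nat.Coprime.mul_left ((Nat.coprime_primes hq₅ hp).mpr (Ne.symm hp₅)) ((Nat.coprime_primes hq₁ hp).mpr (Ne.symm hp₁))),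
        Nat.squarefree_mul ((Nat.coprime_primes hq₅ hq₁).mpr hne)]
      exact ⟨⟨hq₅.squarefree, hq₁.squarefree⟩, hp.squarefree⟩
    have hm' : ∀ r : ℕ, r.Prime → r ∣ q₅ * q₁ * p → r % 4 = 1 ∧ (r % 7 = 3 ∨ r % 7 = 5 ∨ r % 7 = 6) := by
      intro r hr hrd
      rcases (Nat.Prime.dvd_mul hr).mp hrd with h | h
      · rcases (Nat.Prime.dvd_mul hr).mp h with h | h
        · obtain rfl := (Nat.prime_dvd_prime_iff_eq hr hq₅).mp h; exact ⟨hq₅4, hq₅7⟩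
        · obtain rfl := (Nat.prime_dvd_prime_iff_eq hr hq₁).mp h; exact ⟨hq₁4, hq₁7⟩
      · obtain rfl := (Nat.prime_dvd_prime_iff_eq hr hp).mp h; exact ⟨hp4, hp7⟩
    haveI := isElliptic_A (Nat.mul_ne_zero hq₃.ne_zero (Nat.mul_ne_zero (Nat.mul_ne_zero hq₅.ne_zero hq₁.ne_zero) hp.ne_zero))
    exact (L_one_ne_zero_A hBT hH hq₃ hq₃8 hq₃7 (Nat.mul_pos (Nat.mul_pos hq₅.pos hq₁.pos) hp.pos) hm'sq hq₃m hm').2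

end Rung

/-! ## §3 The class numbers and the eight rungs -/

section Rungs

/-- `h(ℚ(√−255)) = 12` (`255 = 3·5·17`). [cite: Cox2013, §2.A Thm. 2.13; §7.B Thm. 7.7(ii)] -/
theorem binQF_classNumber_neg255 : BinQF.classNumber (-255) = 12 := by decide +kernel

/-- `h(ℚ(√−615)) = 20` (`615 = 3·5·41`). [cite: Cox2013, §2.A Thm. 2.13; §7.B Thm. 7.7(ii)] -/
theorem binQF_classNumber_neg615 : BinQF.classNumber (-615) = 20 := by decide +kernel

/-- `h(ℚ(√−663)) = 16` (`663 = 3·13·17`). [cite: Cox2013, §2.A Thm. 2.13; §7.B Thm. 7.7(ii)] -/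
theorem binQF_classNumber_neg663 : BinQF.classNumber (-663) = 16 := by decide +kernel

/-- `h(ℚ(√−1095)) = 28` (`1095 = 3·5·73`). [cite: Cox2013, §2.A Thm. 2.13; §7.B Thm. 7.7(ii)] -/
theorem binQF_classNumber_neg1095 : BinQF.classNumber (-1095) = 28 := by decide +kernel

/-- `h(ℚ(√−1335)) = 28` (`1335 = 3·5·89`). [cite: Cox2013, §2.A Thm. 2.13; §7.B Thm. 7.7(ii)] -/
theorem binQF_classNumber_neg1335 : BinQF.classNumber (-1335) = 28 := by decide +kernel

/-- `h(ℚ(√−1455)) = 28` (`1455 = 3·5·97`). [cite: Cox2013, §2.A Thm. 2.13; §7.B Thm. 7.7(ii)] -/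
theorem binQF_classNumber_neg1455 : BinQF.classNumber (-1455) = 28 := by decide +kernel

/-- `h(ℚ(√−1599)) = 36` (`1599 = 3·13·41`). [cite: Cox2013, §2.A Thm. 2.13; §7.B Thm. 7.7(ii)] -/
theorem binQF_classNumber_neg1599 : BinQF.classNumber (-1599) = 36 := by decide +kernel

/-- `h(ℚ(√−1615)) = 24` (`1615 = 19·5·17`). [cite: Cox2013, §2.A Thm. 2.13; §7.B Thm. 7.7(ii)] -/
theorem binQF_classNumber_neg1615 : BinQF.classNumber (-1615) = 24 := by decide +kernel

/-- ★★ **Rung `255 = 3·5·17`** (`K′ = ℚ(√−255)`, `h = 12`): for every prime `p ≡ 1 (mod 4)`, `p ≡ 3, 5, 6 (mod 7)`, with `(−255/p) = +1` and `p > 12`,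
the conclusion of crux 21381 for `W = X₀(49)^{(−p)} = ⟨0, −21p, 0, 112p², 0⟩`, modulo Burungale–Tian + Deuring–Hecke. [cite: BurungaleTian2026, Thm. 1.1]
[cite: SilvermanATAEC1994, Ch. II Cor. 10.5.1] -/
theorem rung255 (hBT : burungaleTian_analyticRank_eq_zero_of_selmerCorank_eq_zero_of_hasCM)
    (hH : hasEntireLFunction_of_j_mem_maximalCMJInvariants) :
    ∀ (p : ℕ) [Fact p.Prime], p % 4 = 1 → (p % 7 = 3 ∨ p % 7 = 5 ∨ p % 7 = 6) → jacobiSym (-255) p = 1 → 12 < p →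
      ∃ (K : Type) (_ : Field K) (_ : NumberField K),
        IsImaginaryQuadratic K ∧ 4 < (NumberField.discr K).natAbs ∧
        SatisfiesHeegnerHypothesis ((⟨0, -21 * (p : ℚ), 0, 112 * (p : ℚ) ^ 2, 0⟩ : WeierstrassCurve ℚ).conductorNorm ℤ) K ∧
        ((⟨0, -21 * (p : ℚ), 0, 112 * (p : ℚ) ^ 2, 0⟩ : WeierstrassCurve ℚ).quadraticTwist (NumberField.discr K : ℚ)).entireLFunction 1 ≠ 0 ∧
        NumberField.classNumber K < p ∧ ¬ p ∣ NumberField.classNumber K := by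
  intro p _ hp4 hp7 hJ hh
  exact rung_of_two_facts hBT hH (q₃ := 3) (q₅ := 5) (q₁ := 17) (m := 255) (h₀ := 12) (by norm_num) (by norm_num) (by norm_num)
    (by norm_num) (by norm_num) (by norm_num) (by norm_num) (by norm_num) (by norm_num) (by norm_num) (by norm_num) (by norm_num)
    (by norm_num) (by exact_mod_cast binQF_classNumber_neg255) p hp4 hp7 (by exact_mod_cast hJ) hh

/-- ★★ **Rung `615 = 3·5·41`** (`K′ = ℚ(√−615)`, `h = 20`): for every prime `p ≡ 1 (mod 4)`, `p ≡ 3, 5, 6 (mod 7)`, with `(−615/p) = +1` and `p > 20`,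
the conclusion of crux 21381 for `W = X₀(49)^{(−p)} = ⟨0, −21p, 0, 112p², 0⟩`, modulo Burungale–Tian + Deuring–Hecke. [cite: BurungaleTian2026, Thm. 1.1]
[cite: SilvermanATAEC1994, Ch. II Cor. 10.5.1] -/
theorem rung615 (hBT : burungaleTian_analyticRank_eq_zero_of_selmerCorank_eq_zero_of_hasCM)
    (hH : hasEntireLFunction_of_j_mem_maximalCMJInvariants) :
    ∀ (p : ℕ) [Fact p.Prime], p % 4 = 1 → (p % 7 = 3 ∨ p % 7 = 5 ∨ p % 7 = 6) → jacobiSym (-615) p = 1 → 20 < p →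
      ∃ (K : Type) (_ : Field K) (_ : NumberField K),
        IsImaginaryQuadratic K ∧ 4 < (NumberField.discr K).natAbs ∧
        SatisfiesHeegnerHypothesis ((⟨0, -21 * (p : ℚ), 0, 112 * (p : ℚ) ^ 2, 0⟩ : WeierstrassCurve ℚ).conductorNorm ℤ) K ∧
        ((⟨0, -21 * (p : ℚ), 0, 112 * (p : ℚ) ^ 2, 0⟩ : WeierstrassCurve ℚ).quadraticTwist (NumberField.discr K : ℚ)).entireLFunction 1 ≠ 0 ∧
        NumberField.classNumber K < p ∧ ¬ p ∣ NumberField.classNumber K := by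
  intro p _ hp4 hp7 hJ hh
  exact rung_of_two_facts hBT hH (q₃ := 3) (q₅ := 5) (q₁ := 41) (m := 615) (h₀ := 20) (by norm_num) (by norm_num) (by norm_num)
    (by norm_num) (by norm_num) (by norm_num) (by norm_num) (by norm_num) (by norm_num) (by norm_num) (by norm_num) (by norm_num)
    (by norm_num) (by exact_mod_cast binQF_classNumber_neg615) p hp4 hp7 (by exact_mod_cast hJ) hh

/-- ★★ **Rung `663 = 3·13·17`** (`K′ = ℚ(√−663)`, `h = 16`): for every prime `p ≡ 1 (mod 4)`, `p ≡ 3, 5, 6 (mod 7)`, with `(−663/p) = +1` and `p > 16`,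
the conclusion of crux 21381 for `W = X₀(49)^{(−p)} = ⟨0, −21p, 0, 112p², 0⟩`, modulo Burungale–Tian + Deuring–Hecke. [cite: BurungaleTian2026, Thm. 1.1]
[cite: SilvermanATAEC1994, Ch. II Cor. 10.5.1] -/
theorem rung663 (hBT : burungaleTian_analyticRank_eq_zero_of_selmerCorank_eq_zero_of_hasCM)
    (hH : hasEntireLFunction_of_j_mem_maximalCMJInvariants) :
    ∀ (p : ℕ) [Fact p.Prime], p % 4 = 1 → (p % 7 = 3 ∨ p % 7 = 5 ∨ p % 7 = 6) → jacobiSym (-663) p = 1 → 16 < p →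
      ∃ (K : Type) (_ : Field K) (_ : NumberField K),
        IsImaginaryQuadratic K ∧ 4 < (NumberField.discr K).natAbs ∧
        SatisfiesHeegnerHypothesis ((⟨0, -21 * (p : ℚ), 0, 112 * (p : ℚ) ^ 2, 0⟩ : WeierstrassCurve ℚ).conductorNorm ℤ) K ∧
        ((⟨0, -21 * (p : ℚ), 0, 112 * (p : ℚ) ^ 2, 0⟩ : WeierstrassCurve ℚ).quadraticTwist (NumberField.discr K : ℚ)).entireLFunction 1 ≠ 0 ∧
        NumberField.classNumber K < p ∧ ¬ p ∣ NumberField.classNumber K := by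
  intro p _ hp4 hp7 hJ hh
  exact rung_of_two_facts hBT hH (q₃ := 3) (q₅ := 13) (q₁ := 17) (m := 663) (h₀ := 16) (by norm_num) (by norm_num) (by norm_num)
    (by norm_num) (by norm_num) (by norm_num) (by norm_num) (by norm_num) (by norm_num) (by norm_num) (by norm_num) (by norm_num)
    (by norm_num) (by exact_mod_cast binQF_classNumber_neg663) p hp4 hp7 (by exact_mod_cast hJ) hh

/-- ★★ **Rung `1095 = 3·5·73`** (`K′ = ℚ(√−1095)`, `h = 28`): for every prime `p ≡ 1 (mod 4)`, `p ≡ 3, 5, 6 (mod 7)`, with `(−1095/p) = +1` and `p > 28`,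
the conclusion of crux 21381 for `W = X₀(49)^{(−p)} = ⟨0, −21p, 0, 112p², 0⟩`, modulo Burungale–Tian + Deuring–Hecke. [cite: BurungaleTian2026, Thm. 1.1]
[cite: SilvermanATAEC1994, Ch. II Cor. 10.5.1] -/
theorem rung1095 (hBT : burungaleTian_analyticRank_eq_zero_of_selmerCorank_eq_zero_of_hasCM)
    (hH : hasEntireLFunction_of_j_mem_maximalCMJInvariants) :
    ∀ (p : ℕ) [Fact p.Prime], p % 4 = 1 → (p % 7 = 3 ∨ p % 7 = 5 ∨ p % 7 = 6) → jacobiSym (-1095) p = 1 → 28 < p →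
      ∃ (K : Type) (_ : Field K) (_ : NumberField K),
        IsImaginaryQuadratic K ∧ 4 < (NumberField.discr K).natAbs ∧
        SatisfiesHeegnerHypothesis ((⟨0, -21 * (p : ℚ), 0, 112 * (p : ℚ) ^ 2, 0⟩ : WeierstrassCurve ℚ).conductorNorm ℤ) K ∧
        ((⟨0, -21 * (p : ℚ), 0, 112 * (p : ℚ) ^ 2, 0⟩ : WeierstrassCurve ℚ).quadraticTwist (NumberField.discr K : ℚ)).entireLFunction 1 ≠ 0 ∧
        NumberField.classNumber K < p ∧ ¬ p ∣ NumberField.classNumber K := by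
  intro p _ hp4 hp7 hJ hh
  exact rung_of_two_facts hBT hH (q₃ := 3) (q₅ := 5) (q₁ := 73) (m := 1095) (h₀ := 28) (by norm_num) (by norm_num) (by norm_num)
    (by norm_num) (by norm_num) (by norm_num) (by norm_num) (by norm_num) (by norm_num) (by norm_num) (by norm_num) (by norm_num)
    (by norm_num) (by exact_mod_cast binQF_classNumber_neg1095) p hp4 hp7 (by exact_mod_cast hJ) hh

/-- ★★ **Rung `1335 = 3·5·89`** (`K′ = ℚ(√−1335)`, `h = 28`): for every prime `p ≡ 1 (mod 4)`, `p ≡ 3, 5, 6 (mod 7)`, with `(−1335/p) = +1` and `p > 28`,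
the conclusion of crux 21381 for `W = X₀(49)^{(−p)} = ⟨0, −21p, 0, 112p², 0⟩`, modulo Burungale–Tian + Deuring–Hecke. [cite: BurungaleTian2026, Thm. 1.1]
[cite: SilvermanATAEC1994, Ch. II Cor. 10.5.1] -/
theorem rung1335 (hBT : burungaleTian_analyticRank_eq_zero_of_selmerCorank_eq_zero_of_hasCM)
    (hH : hasEntireLFunction_of_j_mem_maximalCMJInvariants) :
    ∀ (p : ℕ) [Fact p.Prime], p % 4 = 1 → (p % 7 = 3 ∨ p % 7 = 5 ∨ p % 7 = 6) → jacobiSym (-1335) p = 1 → 28 < p →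
      ∃ (K : Type) (_ : Field K) (_ : NumberField K),
        IsImaginaryQuadratic K ∧ 4 < (NumberField.discr K).natAbs ∧
        SatisfiesHeegnerHypothesis ((⟨0, -21 * (p : ℚ), 0, 112 * (p : ℚ) ^ 2, 0⟩ : WeierstrassCurve ℚ).conductorNorm ℤ) K ∧
        ((⟨0, -21 * (p : ℚ), 0, 112 * (p : ℚ) ^ 2, 0⟩ : WeierstrassCurve ℚ).quadraticTwist (NumberField.discr K : ℚ)).entireLFunction 1 ≠ 0 ∧
        NumberField.classNumber K < p ∧ ¬ p ∣ NumberField.classNumber K := by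
  intro p _ hp4 hp7 hJ hh
  exact rung_of_two_facts hBT hH (q₃ := 3) (q₅ := 5) (q₁ := 89) (m := 1335) (h₀ := 28) (by norm_num) (by norm_num) (by norm_num)
    (by norm_num) (by norm_num) (by norm_num) (by norm_num) (by norm_num) (by norm_num) (by norm_num) (by norm_num) (by norm_num)
    (by norm_num) (by exact_mod_cast binQF_classNumber_neg1335) p hp4 hp7 (by exact_mod_cast hJ) hh

/-- ★★ **Rung `1455 = 3·5·97`** (`K′ = ℚ(√−1455)`, `h = 28`): for every prime `p ≡ 1 (mod 4)`, `p ≡ 3, 5, 6 (mod 7)`, with `(−1455/p) = +1` and `p > 28`,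
the conclusion of crux 21381 for `W = X₀(49)^{(−p)} = ⟨0, −21p, 0, 112p², 0⟩`, modulo Burungale–Tian + Deuring–Hecke. [cite: BurungaleTian2026, Thm. 1.1]
[cite: SilvermanATAEC1994, Ch. II Cor. 10.5.1] -/
theorem rung1455 (hBT : burungaleTian_analyticRank_eq_zero_of_selmerCorank_eq_zero_of_hasCM)
    (hH : hasEntireLFunction_of_j_mem_maximalCMJInvariants) :
    ∀ (p : ℕ) [Fact p.Prime], p % 4 = 1 → (p % 7 = 3 ∨ p % 7 = 5 ∨ p % 7 = 6) → jacobiSym (-1455) p = 1 → 28 < p →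
      ∃ (K : Type) (_ : Field K) (_ : NumberField K),
        IsImaginaryQuadratic K ∧ 4 < (NumberField.discr K).natAbs ∧
        SatisfiesHeegnerHypothesis ((⟨0, -21 * (p : ℚ), 0, 112 * (p : ℚ) ^ 2, 0⟩ : WeierstrassCurve ℚ).conductorNorm ℤ) K ∧
        ((⟨0, -21 * (p : ℚ), 0, 112 * (p : ℚ) ^ 2, 0⟩ : WeierstrassCurve ℚ).quadraticTwist (NumberField.discr K : ℚ)).entireLFunction 1 ≠ 0 ∧
        NumberField.classNumber K < p ∧ ¬ p ∣ NumberField.classNumber K := by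
  intro p _ hp4 hp7 hJ hh
  exact rung_of_two_facts hBT hH (q₃ := 3) (q₅ := 5) (q₁ := 97) (m := 1455) (h₀ := 28) (by norm_num) (by norm_num) (by norm_num)
    (by norm_num) (by norm_num) (by norm_num) (by norm_num) (by norm_num) (by norm_num) (by norm_num) (by norm_num) (by norm_num)
    (by norm_num) (by exact_mod_cast binQF_classNumber_neg1455) p hp4 hp7 (by exact_mod_cast hJ) hh

/-- ★★ **Rung `1599 = 3·13·41`** (`K′ = ℚ(√−1599)`, `h = 36`): for every prime `p ≡ 1 (mod 4)`, `p ≡ 3, 5, 6 (mod 7)`, with `(−1599/p) = +1` and `p > 36`,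
the conclusion of crux 21381 for `W = X₀(49)^{(−p)} = ⟨0, −21p, 0, 112p², 0⟩`, modulo Burungale–Tian + Deuring–Hecke. [cite: BurungaleTian2026, Thm. 1.1]
[cite: SilvermanATAEC1994, Ch. II Cor. 10.5.1] -/
theorem rung1599 (hBT : burungaleTian_analyticRank_eq_zero_of_selmerCorank_eq_zero_of_hasCM)
    (hH : hasEntireLFunction_of_j_mem_maximalCMJInvariants) :
    ∀ (p : ℕ) [Fact p.Prime], p % 4 = 1 → (p % 7 = 3 ∨ p % 7 = 5 ∨ p % 7 = 6) → jacobiSym (-1599) p = 1 → 36 < p →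
      ∃ (K : Type) (_ : Field K) (_ : NumberField K),
        IsImaginaryQuadratic K ∧ 4 < (NumberField.discr K).natAbs ∧
        SatisfiesHeegnerHypothesis ((⟨0, -21 * (p : ℚ), 0, 112 * (p : ℚ) ^ 2, 0⟩ : WeierstrassCurve ℚ).conductorNorm ℤ) K ∧
        ((⟨0, -21 * (p : ℚ), 0, 112 * (p : ℚ) ^ 2, 0⟩ : WeierstrassCurve ℚ).quadraticTwist (NumberField.discr K : ℚ)).entireLFunction 1 ≠ 0 ∧
        NumberField.classNumber K < p ∧ ¬ p ∣ NumberField.classNumber K := by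
  intro p _ hp4 hp7 hJ hh
  exact rung_of_two_facts hBT hH (q₃ := 3) (q₅ := 13) (q₁ := 41) (m := 1599) (h₀ := 36) (by norm_num) (by norm_num) (by norm_num)
    (by norm_num) (by norm_num) (by norm_num) (by norm_num) (by norm_num) (by norm_num) (by norm_num) (by norm_num) (by norm_num)
    (by norm_num) (by exact_mod_cast binQF_classNumber_neg1599) p hp4 hp7 (by exact_mod_cast hJ) hh

/-- ★★ **Rung `1615 = 19·5·17`** (`K′ = ℚ(√−1615)`, `h = 24`): for every prime `p ≡ 1 (mod 4)`, `p ≡ 3, 5, 6 (mod 7)`, with `(−1615/p) = +1` and `p > 24`,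
the conclusion of crux 21381 for `W = X₀(49)^{(−p)} = ⟨0, −21p, 0, 112p², 0⟩`, modulo Burungale–Tian + Deuring–Hecke. [cite: BurungaleTian2026, Thm. 1.1]
[cite: SilvermanATAEC1994, Ch. II Cor. 10.5.1] -/
theorem rung1615 (hBT : burungaleTian_analyticRank_eq_zero_of_selmerCorank_eq_zero_of_hasCM)
    (hH : hasEntireLFunction_of_j_mem_maximalCMJInvariants) :
    ∀ (p : ℕ) [Fact p.Prime], p % 4 = 1 → (p % 7 = 3 ∨ p % 7 = 5 ∨ p % 7 = 6) → jacobiSym (-1615) p = 1 → 24 < p →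
      ∃ (K : Type) (_ : Field K) (_ : NumberField K),
        IsImaginaryQuadratic K ∧ 4 < (NumberField.discr K).natAbs ∧
        SatisfiesHeegnerHypothesis ((⟨0, -21 * (p : ℚ), 0, 112 * (p : ℚ) ^ 2, 0⟩ : WeierstrassCurve ℚ).conductorNorm ℤ) K ∧
        ((⟨0, -21 * (p : ℚ), 0, 112 * (p : ℚ) ^ 2, 0⟩ : WeierstrassCurve ℚ).quadraticTwist (NumberField.discr K : ℚ)).entireLFunction 1 ≠ 0 ∧
        NumberField.classNumber K < p ∧ ¬ p ∣ NumberField.classNumber K := by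
  intro p _ hp4 hp7 hJ hh
  exact rung_of_two_facts hBT hH (q₃ := 19) (q₅ := 5) (q₁ := 17) (m := 1615) (h₀ := 24) (by norm_num) (by norm_num) (by norm_num)
    (by norm_num) (by norm_num) (by norm_num) (by norm_num) (by norm_num) (by norm_num) (by norm_num) (by norm_num) (by norm_num)
    (by norm_num) (by exact_mod_cast binQF_classNumber_neg1615) p hp4 hp7 (by exact_mod_cast hJ) hh

end Rungs

end Summit.BirchSwinnertonDyer.BirchSwinnertonDyer.Theorems.BiquadraticEisensteinDescentHeegnerTwistCouplingInSupplySqrtSevenRungs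

end
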